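import Summits.PneNP.PneNP.Theorems.ChebyshevTracialDesignScalarTiltFixedDirection
import Summits.PneNP.PneNP.Theorems.ChebyshevTracialDesignFreeBoundedDimension
import Summits.PneNP.PneNP.Theorems.ChebyshevTracialDesignPureStateReduction
import HarnessLib

/-!
# Cell pnp-psdrank, route `ChebyshevTracialDesign`: DIRECTION FIELDS OF RANK `k` ARE FREE PSD STRATEGIES OF DIMENSION `k` — the per-cut
# statement (PC) on fields confined to a fixed `k`-dimensional space of directions is priced by the free bounded-dimension theorem
# (brick 170c; crux `TracialDecayExp20`, stmt-PneNP-19878)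

Brick 170c (prover g33; MEMO-36 §3), after bricks 170/170b (`…ScalarTiltFixedDirection[Decay]`: scalar tilts `h(M)·u` of ONE fixed direction,
rate `a` of the `r = 1` rung). Notation: `x_p = 1[p ∈ U]`, `π_M` the partner map, `L_v(U) = Σ_p v_p x_p` the linear and
`C_v(U) = Σ_p v_p x_p x_{π_M p}` the containment form of a direction field `v : PM → ℝⁿ`.
THE OBSERVATION. In the LINEAR form the per-cut value of a field is `Σ_M W(U,M)·L_{v_M}(U)²`, and if every `v_M` lies in the span of `k` fixed
directions, `v_M = Σ_{i<k} α_M(i)·u^i` (`|u^i_p| ≤ 1`, `|α_M(i)| ≤ 1`), then `L_{v_M}(U) = Σ_i α_M(i)·ℓ_U(i)` with the CUT-ONLY vector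
`ℓ_U(i) = L_{u^i}(U)`, so `L_{v_M}(U)² = n²k⁴·tr(A_U B_M)` for the PURE psd contractions `A_U = a_Ua_Uᵀ`, `B_M = b_Mb_Mᵀ` of dimension `k`
(`a_U = ℓ_U/(nk)`, `b_M = α_M/k`, norms `≤ 1`): the masked per-cut sum `Σ_U f(U)·Σ_M W L_{v_M}(U)²` IS the free (tightness-free) design value of a
psd strategy of dimension `k`, and brick 85b (`…FreeBoundedDimension.free_tracialDecay_boundedDim`, UNCONDITIONAL, rate `a' = a'(k)`) prices it.
Brick 170's §2 (`perCut_posPart_containment_le_linear_add`, brick 101) moves the bound to the containment form.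
* §1 `linearForm_span_eq` (`L_{v_M}(U) = nk²·⟨a_U, b_M⟩`), `dot_self_le_cut` / `dot_self_le_match` (the two norm bounds),
  **`sum_mask_linear_rankK_eq_trace`** (the masked linear per-cut sum `= n²k⁴·Σ_{U,M} W tr((f(U)A_U) B_M)`).
* §2 **`rankK_perCut_decay`** — UNCONDITIONAL for the crux's balanced Chebyshev designs: for every `k` there are `a' > 0`, `n₁` with: for even
  `n ≥ n₁`, every `IsBalancedDesign n t (Tq n) (dq n) 20 C w`, every `k` directions `|u^i| ≤ 1` and coefficients `|α_M(i)| ≤ 1` with `|v_M| ≤ 1`,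
  `Σ_U (Σ_M W(U,M) C_{v_M}(U)²)₊ ≤ n²k⁵·e^{−a'·dq n} + 3n⁴·20·√P_{dq n−4}`.
READING (MEMO-36 §3). (PC) in the linear form is the free crux for PURE strategies whose cut side is the canonical embedding `U ↦ x_U` (masked) and
whose matching side `b_M ∈ ℝⁿ` is arbitrary; confining `b_M` to a `k`-dimensional subspace projects the cut side with it, leaving a free strategy of
dimension `k`. So on MEMO-35 §4's M-dependence axis the priced region is «directions in a subspace of dimension `k = O(1)`» (this file; `k = 1` with the
full rate `a` is brick 170), and the open residue is fields whose directions span `e^{Ω(dq n)}`… in fact `poly(n)` dimensions as `M` varies —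
the smallest named instance being `v_M(p) = h(M)·ν(p, π_M p)` for a fixed signed EDGE weighting `ν` (MEMO-36 §2). WHAT THIS FILE DOES NOT DO:
anything for `k` growing with `n`; anything on `TracialDecayExp20` itself, psd rank of P_PM(K_n), or P vs NP.
[cite: Rothvoss2017, §2 and Lemma 7 (PDF pp. 6–8)] [cite: KeevashLifshitz2023, Thm. 1.8] [cite: BrietDadushPokutta2014, Thm. 6 (§3)]
[cite: FawziSaundersonParrilo2013, Thm. 4 (proof, p. 10)]
Stature: support/instrument (kernel lane, no defs, axioms standard). Supports stmt-PneNP-19878.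
-/

set_option linter.dupNamespace false -- `Summit.PneNP.PneNP.…`: summit = sub-problem (D-0017)

noncomputable section

namespace Summit.PneNP.PneNP.Theorems.ChebyshevTracialDesignRankKDirectionFields

open Finset Matrix Literature.Barriers.PneNP Literature.Combinatorics.Optimization
open Summit.PneNP.PneNP.Theorems.ChebyshevTracialDesignScalarTiltFixedDirection (perCut_posPart_containment_le_linear_add)
open Summit.PneNP.PneNP.Theorems.ChebyshevTracialDesignFreeBoundedDimension (free_tracialDecay_boundedDim)
open Summit.PneNP.PneNP.Theorems.ChebyshevTracialDesignPureStateReduction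
  (posSemidef_vecMulVec posSemidef_one_sub_vecMulVec trace_vecMulVec_mul_vecMulVec')

variable {n k : ℕ}

/-! ### §1 The linear form of a rank-`k` field is a pure psd strategy of dimension `k` -/

/-- The linear form of `v_M = Σ_i α_M(i) u^i` on a cut: `Σ_p (Σ_i α_M(i) u^i_p) x_p = Σ_i α_M(i)·ℓ_U(i)` with `ℓ_U(i) = Σ_p u^i_p x_p`, i.e.
`= (nk²)·⟨ℓ_U/(nk), α_M/k⟩` (for `n, k ≥ 1`). [folklore] -/
theorem linearForm_span_eq (hn : 0 < n) (hk : 0 < k) (u : Fin k → Fin n → ℝ) (α : Fin k → ℝ) (U : OddSet n) :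
    ∑ p, (∑ i, α i * u i p) * (if p ∈ U.1 then (1 : ℝ) else 0) =
      ((n : ℝ) * (k : ℝ) ^ 2) *
        ((fun i => (∑ p, u i p * (if p ∈ U.1 then (1 : ℝ) else 0)) / ((n : ℝ) * k)) ⬝ᵥ (fun i => α i / k)) := by
  have hn' : (n : ℝ) ≠ 0 := by exact_mod_cast hn.ne'
  have hk' : (k : ℝ) ≠ 0 := by exact_mod_cast hk.ne'
  unfold dotProduct
  rw [mul_sum]
  have : ∑ p, (∑ i, α i * u i p) * (if p ∈ U.1 then (1 : ℝ) else 0) =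
      ∑ i, α i * ∑ p, u i p * (if p ∈ U.1 then (1 : ℝ) else 0) := by
    simp_rw [sum_mul, mul_sum]
    rw [sum_comm]
    exact sum_congr rfl fun i _ => sum_congr rfl fun p _ => by ring
  rw [this]
  exact sum_congr rfl fun i _ => by field_simp

/-- Norm bound on the cut side: `|ℓ_U/(nk)|² ≤ 1` when `|u^i_p| ≤ 1` (`n, k ≥ 1`). [folklore] -/
theorem dot_self_le_cut (hn : 0 < n) (hk : 0 < k) (u : Fin k → Fin n → ℝ) (hu : ∀ i p, |u i p| ≤ 1) (U : OddSet n) :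
    (fun i => (∑ p, u i p * (if p ∈ U.1 then (1 : ℝ) else 0)) / ((n : ℝ) * k)) ⬝ᵥ
      (fun i => (∑ p, u i p * (if p ∈ U.1 then (1 : ℝ) else 0)) / ((n : ℝ) * k)) ≤ 1 := by
  have hn' : (0 : ℝ) < n := by exact_mod_cast hn
  have hk' : (0 : ℝ) < k := by exact_mod_cast hk
  have hk1 : (1 : ℝ) ≤ k := by exact_mod_cast hk
  have hL : ∀ i, (∑ p, u i p * (if p ∈ U.1 then (1 : ℝ) else 0)) ^ 2 ≤ (n : ℝ) ^ 2 := fun i =>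
    ChebyshevTracialDesignScalarTiltFixedDirection.linearForm_sq_le (u i) (hu i) U
  unfold dotProduct
  calc ∑ i, (∑ p, u i p * (if p ∈ U.1 then (1 : ℝ) else 0)) / ((n : ℝ) * k) *
          ((∑ p, u i p * (if p ∈ U.1 then (1 : ℝ) else 0)) / ((n : ℝ) * k))
      = ∑ i, (∑ p, u i p * (if p ∈ U.1 then (1 : ℝ) else 0)) ^ 2 / (((n : ℝ) * k) ^ 2) :=
        sum_congr rfl fun i _ => by rw [div_mul_div_comm, ← sq, ← sq]
    _ ≤ ∑ _i : Fin k, (n : ℝ) ^ 2 / (((n : ℝ) * k) ^ 2) :=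
        sum_le_sum fun i _ => div_le_div_of_nonneg_right (hL i) (by positivity)
    _ = (k : ℝ) * ((n : ℝ) ^ 2 / (((n : ℝ) * k) ^ 2)) := by rw [sum_const, card_univ, Fintype.card_fin, nsmul_eq_mul]
    _ = 1 / k := by field_simp
    _ ≤ 1 := by rw [div_le_one hk']; exact hk1

/-- Norm bound on the matching side: `|α_M/k|² ≤ 1` when `|α_M(i)| ≤ 1` (`k ≥ 1`). [folklore] -/
theorem dot_self_le_match (hk : 0 < k) (α : Fin k → ℝ) (hα : ∀ i, |α i| ≤ 1) :
    (fun i => α i / k) ⬝ᵥ (fun i => α i / k) ≤ 1 := by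
  have hk' : (0 : ℝ) < k := by exact_mod_cast hk
  have hk1 : (1 : ℝ) ≤ k := by exact_mod_cast hk
  have hsq : ∀ i, α i * α i ≤ 1 := fun i => by
    have := hα i
    rw [abs_le] at this
    nlinarith [this.1, this.2]
  unfold dotProduct
  calc ∑ i, α i / k * (α i / k) = ∑ i, α i * α i / ((k : ℝ) ^ 2) :=
        sum_congr rfl fun i _ => by ring
    _ ≤ ∑ _i : Fin k, 1 / ((k : ℝ) ^ 2) := sum_le_sum fun i _ => div_le_div_of_nonneg_right (hsq i) (by positivity)
    _ = (k : ℝ) * (1 / (k : ℝ) ^ 2) := by rw [sum_const, card_univ, Fintype.card_fin, nsmul_eq_mul]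
    _ = 1 / k := by field_simp
    _ ≤ 1 := by rw [div_le_one hk']; exact hk1

/-- **The masked linear per-cut sum of a rank-`k` field is the free design value of a pure psd strategy of dimension `k`.** For any weight `W`,
any {0,1}-valued (indeed any) mask `f`, directions `u^i` and coefficients `α_M`:
`Σ_U f(U)·Σ_M W(U,M)·L_{v_M}(U)² = n²k⁴·Σ_U Σ_M W(U,M)·tr((f(U)·a_Ua_Uᵀ)(b_Mb_Mᵀ))` with `a_U = ℓ_U/(nk)`, `b_M = α_M/k`.
[cite: FawziSaundersonParrilo2013, Thm. 4 (proof, p. 10)] [cite: BrietDadushPokutta2014, Thm. 6 (§3)] -/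
theorem sum_mask_linear_rankK_eq_trace (hn : 0 < n) (hk : 0 < k) (W : OddSet n → PMatch n → ℝ) (f : OddSet n → ℝ)
    (u : Fin k → Fin n → ℝ) (α : PMatch n → Fin k → ℝ) :
    ∑ U : OddSet n, f U * ∑ M : PMatch n, W U M * (∑ p, (∑ i, α M i * u i p) * (if p ∈ U.1 then (1 : ℝ) else 0)) ^ 2 =
      ((n : ℝ) ^ 2 * (k : ℝ) ^ 4) * ∑ U : OddSet n, ∑ M : PMatch n, W U M *
        ((f U • vecMulVec (fun i => (∑ p, u i p * (if p ∈ U.1 then (1 : ℝ) else 0)) / ((n : ℝ) * k))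
            (fun i => (∑ p, u i p * (if p ∈ U.1 then (1 : ℝ) else 0)) / ((n : ℝ) * k))) *
          vecMulVec (fun i => α M i / k) (fun i => α M i / k)).trace := by
  rw [mul_sum]
  refine sum_congr rfl fun U _ => ?_
  rw [mul_sum, mul_sum]
  refine sum_congr rfl fun M _ => ?_
  rw [linearForm_span_eq hn hk u (α M) U, Matrix.smul_mul, trace_smul, smul_eq_mul, trace_vecMulVec_mul_vecMulVec']
  ring

/-! ### §2 The per-cut statement for rank-`k` fields — unconditional for the crux's designs -/

/-- **DIRECTION FIELDS OF RANK `k` ARE PRICED (per cut, containment form), UNCONDITIONALLY for the crux's balanced Chebyshev designs.** For every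
`k` there are `a' > 0` and `n₁` such that for all even `n ≥ n₁`, every `IsBalancedDesign n t (Tq n) (dq n) 20 C w`, every `k` fixed directions
`|u^i_p| ≤ 1` and every coefficient field `|α_M(i)| ≤ 1` whose field `v_M = Σ_i α_M(i) u^i` has `|v_M(p)| ≤ 1`:
`Σ_U (Σ_M W(U,M)·C_{v_M}(U)²)₊ ≤ n²k⁵·e^{−a'·dq n} + 3n⁴·20·√P_{dq n−4}` (`a' = a'(k)` of brick 85b). [cite: Rothvoss2017, §2 and Lemma 7 (PDF pp. 6–8)]
[cite: KeevashLifshitz2023, Thm. 1.8] [cite: BrietDadushPokutta2014, Thm. 6 (§3)] -/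
theorem rankK_perCut_decay (k : ℕ) :
    ∃ a' : ℝ, 0 < a' ∧ ∃ n₁ : ℕ, ∀ n : ℕ, n₁ ≤ n → Even n → ∀ (t : ℕ) (C : Finset ℕ) (w : ℕ → ℝ),
      IsBalancedDesign n t (Tq n) (dq n) 20 C w → ∀ (u : Fin k → Fin n → ℝ), (∀ i p, |u i p| ≤ 1) →
        ∀ (α : PMatch n → Fin k → ℝ), (∀ M i, |α M i| ≤ 1) → (∀ M p, |∑ i, α M i * u i p| ≤ 1) →
        ∑ U : OddSet n, max (∑ M : PMatch n, levelWeight n t C w U M *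
          (∑ p, (∑ i, α M i * u i p) * ((if p ∈ U.1 then (1 : ℝ) else 0) * (if M.2.partner p ∈ U.1 then (1 : ℝ) else 0))) ^ 2) 0 ≤
        (n : ℝ) ^ 2 * (k : ℝ) ^ 5 * Real.exp (-(a' * (dq n : ℝ))) +
          3 * (n : ℝ) ^ 4 * (20 * Real.sqrt (∏ i ∈ range ((dq n - 4) / 2 + 1), ((2 * i + 1 : ℝ) / ((n : ℝ) - 2 * i)))) := by
  classical
  obtain ⟨a', ha', n₁, h85⟩ := free_tracialDecay_boundedDim k
  refine ⟨a', ha', max n₁ 256, fun n hn hev t C w hdes u hu α hα hv1 => ?_⟩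
  have hn₁ : n₁ ≤ n := le_trans (le_max_left _ _) hn
  have hn256 : 256 ≤ n := le_trans (le_max_right _ _) hn
  have hn0 : 0 < n := by omega
  have hex : IsExactDesign n t (Tq n) (dq n) 20 C w := hdes.1
  obtain ⟨c', hc'⟩ := hex.1
  subst hc'
  have hD4 : 4 ≤ dq n := by
    unfold dq
    exact Nat.le_sqrt.2 (Nat.le_sqrt.2 (by omega))
  have hDc : dq n ≤ 2 * c' := by
    have h1 : dq n ≤ Nat.sqrt n := Nat.sqrt_le_self _
    have h2 := hex.2.2.1
    unfold Tq at h2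
    omega
  have hvar : ∑ c ∈ C, |w c| ≤ 20 := hex.2.2.2.2.2.2
  set W := levelWeight n (2 * c' + 1) C w with hW
  -- the tail term is nonnegative
  have htail : 0 ≤ 3 * (n : ℝ) ^ 4 *
      (20 * Real.sqrt (∏ i ∈ range ((dq n - 4) / 2 + 1), ((2 * i + 1 : ℝ) / ((n : ℝ) - 2 * i)))) := by positivity
  -- containment form ≤ linear form + tail (brick 170 §2 / brick 101)
  have h170 := perCut_posPart_containment_le_linear_add hev hex hDc hD4 (fun M p => ∑ i, α M i * u i p) hv1
  have htail' : 3 * (n : ℝ) ^ 4 * ((∑ c ∈ C, |w c|) *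
      Real.sqrt (∏ i ∈ range ((dq n - 4) / 2 + 1), ((2 * i + 1 : ℝ) / ((n : ℝ) - 2 * i)))) ≤
      3 * (n : ℝ) ^ 4 * (20 * Real.sqrt (∏ i ∈ range ((dq n - 4) / 2 + 1), ((2 * i + 1 : ℝ) / ((n : ℝ) - 2 * i)))) :=
    mul_le_mul_of_nonneg_left (mul_le_mul_of_nonneg_right hvar (Real.sqrt_nonneg _)) (by positivity)
  -- the linear-form positive part
  set g : OddSet n → ℝ := fun U => ∑ M : PMatch n, W U M *
      (∑ p, (∑ i, α M i * u i p) * (if p ∈ U.1 then (1 : ℝ) else 0)) ^ 2 with hg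
  suffices hlin : ∑ U, max (g U) 0 ≤ (n : ℝ) ^ 2 * (k : ℝ) ^ 5 * Real.exp (-(a' * (dq n : ℝ))) by
    refine h170.trans ?_
    exact add_le_add hlin htail'
  rcases Nat.eq_zero_or_pos k with hk0 | hk
  · -- no directions: the field vanishes
    subst hk0
    have hg0 : ∀ U, g U = 0 := fun U => by
      rw [hg]; dsimp only
      exact sum_eq_zero fun M _ => by simp
    simp [hg0]
  -- the selector mask and the pure strategy
  set f : OddSet n → ℝ := fun U => if 0 < g U then (1 : ℝ) else 0 with hf
  have hfg : ∀ U, max (g U) 0 = f U * g U := fun U => by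
    rw [hf]; dsimp only
    by_cases hpos : 0 < g U
    · rw [if_pos hpos, one_mul, max_eq_left hpos.le]
    · rw [if_neg hpos, zero_mul, max_eq_right (not_lt.1 hpos)]
  set a : OddSet n → Fin k → ℝ := fun U i => (∑ p, u i p * (if p ∈ U.1 then (1 : ℝ) else 0)) / ((n : ℝ) * k) with ha
  set b : PMatch n → Fin k → ℝ := fun M i => α M i / k with hb
  set X : OddSet n → Matrix (Fin k) (Fin k) ℝ := fun U => f U • vecMulVec (a U) (a U) with hX
  set Y : PMatch n → Matrix (Fin k) (Fin k) ℝ := fun M => vecMulVec (b M) (b M) with hY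
  have hXpsd : ∀ U, (X U).PosSemidef ∧ (1 - X U).PosSemidef := fun U => by
    rw [hX]; dsimp only; rw [hf]; dsimp only
    by_cases hpos : 0 < g U
    · rw [if_pos hpos, one_smul]
      exact ⟨posSemidef_vecMulVec _, posSemidef_one_sub_vecMulVec (dot_self_le_cut hn0 hk u hu U)⟩
    · rw [if_neg hpos, zero_smul, sub_zero]
      exact ⟨PosSemidef.zero, PosSemidef.one⟩
  have hYpsd : ∀ M, (Y M).PosSemidef ∧ (1 - Y M).PosSemidef := fun M =>
    ⟨posSemidef_vecMulVec _, posSemidef_one_sub_vecMulVec (dot_self_le_match hk (α M) (hα M))⟩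
  have hfree := h85 n hn₁ hev _ C w hdes k hk le_rfl X Y hXpsd hYpsd
  have hk' : (0 : ℝ) < k := by exact_mod_cast hk
  rw [div_le_iff₀ hk'] at hfree
  have hid := sum_mask_linear_rankK_eq_trace hn0 hk W f u α
  calc ∑ U, max (g U) 0 = ∑ U, f U * g U := sum_congr rfl fun U _ => hfg U
    _ = ((n : ℝ) ^ 2 * (k : ℝ) ^ 4) * ∑ U : OddSet n, ∑ M : PMatch n, W U M * (X U * Y M).trace := hid
    _ ≤ ((n : ℝ) ^ 2 * (k : ℝ) ^ 4) * (Real.exp (-(a' * (dq n : ℝ))) * k) :=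
        mul_le_mul_of_nonneg_left hfree (by positivity)
    _ = (n : ℝ) ^ 2 * (k : ℝ) ^ 5 * Real.exp (-(a' * (dq n : ℝ))) := by ring

end Summit.PneNP.PneNP.Theorems.ChebyshevTracialDesignRankKDirectionFields
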